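import Summits.QuantumFields.QCD.Theses.SpectralDefectExtinction
import Literature.MathematicalPhysics.QuantumFieldTheory.QCDPhaseQuenched
import Literature.MathematicalPhysics.QuantumFieldTheory.SpectralDefectDensity
import Literature.Barriers.QuantumFields.WilsonDeterminantMassSplitting

/-!
# Stub `recentreGeometry` of line `Sketch` (skeleton "ResolventCell") for crux
`SpectralDefectExtinction.WegnerEstimate` (item stmt-QuantumFields-8966)

Pure torus arithmetic behind the recentring step of the exterior elimination.  For `L ≥ 2R+4`
and a site `x` of the big torus `(ZMod L)^4`, the map
`σ s := x + Torus.proj L (valMinAbs ∘ s)` reads a site `s` of the small torus `(ZMod (2R+3))^4`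
through its balanced representatives (which lie in `[-(R+1), R+1]`) and places it around `x`.
We show: `σ` is injective; its image is exactly the radius-`(R+1)` cube
`{x + proj_L y : y ∈ box 4 (R+1)}`; `σ s₀` lies in the radius-`R` cube around `x` iff `s₀`
lies in the radius-`R` cube around `0`; and `σ 0 = x`.

Everything is coordinatewise; the two number-theoretic inputs are that balanced representatives
mod `2R+3` range over `[-(R+1), R+1]` (`ZMod.natAbs_valMinAbs_le`, `ZMod.valMinAbs_spec`) and
that two integers of absolute value `≤ R+1` with the same residue mod `L ≥ 2R+4` coincide
(`Int.eq_zero_of_abs_lt_dvd`).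
-/

noncomputable section

namespace Summit.QuantumFields.QCD.Cruxes.WegnerEstimate.ResolventCell

open MeasureTheory
open scoped Matrix BigOperators
open Literature.MathematicalPhysics.QuantumLattice Literature.MathematicalPhysics.QuantumFieldTheory
  Literature.Probability.LatticeModels
open Literature.Barriers.QuantumFields (isHermitian_gammaFive_mul_wilsonDirac)
open Matrix
open scoped ComplexOrder

/-- Balanced representatives on the `(2R+3)`-torus lie in `[-(R+1), R+1]`. -/
theorem recentreGeometry_abs_valMinAbs_le (R : ℕ) (s : ZMod (2 * R + 3)) :
    |s.valMinAbs| ≤ (R : ℤ) + 1 := by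
  haveI : NeZero (2 * R + 3) := ⟨by omega⟩
  have h := ZMod.natAbs_valMinAbs_le s
  have h2 : (2 * R + 3) / 2 = R + 1 := by omega
  rw [h2] at h
  rw [Int.abs_eq_natAbs]
  exact_mod_cast h

/-- An integer of absolute value `≤ R+1` is the balanced representative of its residue on the
`(2R+3)`-torus. -/
theorem recentreGeometry_valMinAbs_intCast (R : ℕ) (y : ℤ) (hy : |y| ≤ (R : ℤ) + 1) :
    (y : ZMod (2 * R + 3)).valMinAbs = y := by
  haveI : NeZero (2 * R + 3) := ⟨by omega⟩
  rw [ZMod.valMinAbs_spec]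
  rw [abs_le] at hy
  refine ⟨rfl, ?_, ?_⟩
  · push_cast
    omega
  · push_cast
    omega

/-- Two integers of absolute value `≤ R+1` with the same residue mod `L ≥ 2R+4` are equal. -/
theorem recentreGeometry_intCast_eq (R L : ℕ) (hL : 2 * R + 4 ≤ L) (a b : ℤ)
    (ha : |a| ≤ (R : ℤ) + 1) (hb : |b| ≤ (R : ℤ) + 1) (h : (a : ZMod L) = (b : ZMod L)) :
    a = b := by
  rw [ZMod.intCast_eq_intCast_iff_dvd_sub] at h
  rw [abs_le] at ha hb
  have h0 : b - a = 0 := by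
    refine Int.eq_zero_of_abs_lt_dvd h ?_
    rw [abs_lt]
    constructor <;> omega
  omega

/-- Membership in `box 4 n` as a bound on absolute values of the coordinates. -/
theorem recentreGeometry_mem_box_iff (n : ℕ) (y : Fin 4 → ℤ) :
    y ∈ box 4 n ↔ ∀ i, |y i| ≤ (n : ℤ) := by
  rw [mem_box]
  refine forall_congr' fun i => ?_
  rw [abs_le]

/-- **Stub `recentreGeometry` (torus arithmetic of the recentring map).**  For `L ≥ 2R+4` the map
`s ↦ x + proj_L (valMinAbs ∘ s)` embeds the `(2R+3)`-torus into the `L`-torus, onto the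
radius-`(R+1)` cube around `x`; it carries the radius-`R` cube around `0` onto the radius-`R`
cube around `x`, and `0` to `x`. -/
theorem stub_recentreGeometry (R L₀ : ℕ) [NeZero L₀] (hL₀ : L₀ = 2 * R + 3) (L : ℕ) [NeZero L]
    (hL : 2 * R + 4 ≤ L) (x : TorusSite 4 L) :
    (Function.Injective fun s : TorusSite 4 L₀ => x + Torus.proj L (fun i => ((s i).valMinAbs : ℤ))) ∧
    (∀ s : TorusSite 4 L, (∃ y ∈ box 4 (R + 1), s = x + Torus.proj L y) ↔
        ∃ s₀ : TorusSite 4 L₀, x + Torus.proj L (fun i => ((s₀ i).valMinAbs : ℤ)) = s) ∧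
    (∀ s₀ : TorusSite 4 L₀,
        (∃ y ∈ box 4 R, x + Torus.proj L (fun i => ((s₀ i).valMinAbs : ℤ)) = x + Torus.proj L y) ↔
        ∃ y ∈ box 4 R, s₀ = 0 + Torus.proj L₀ y) ∧
    (x + Torus.proj L (fun i => (((0 : TorusSite 4 L₀) i).valMinAbs : ℤ)) = x) := by
  subst hL₀
  refine ⟨?_, ?_, ?_, ?_⟩
  · -- injectivity
    intro s t hst
    have h : (Torus.proj L fun i => ((s i).valMinAbs : ℤ)) =
        Torus.proj L fun i => ((t i).valMinAbs : ℤ) :=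
      add_left_cancel hst
    funext i
    have hi := congr_fun h i
    simp only [Torus.proj_apply] at hi
    exact ZMod.valMinAbs_inj.1 (recentreGeometry_intCast_eq R L hL _ _
      (recentreGeometry_abs_valMinAbs_le R (s i)) (recentreGeometry_abs_valMinAbs_le R (t i)) hi)
  · -- the image is the radius-(R+1) cube around x
    intro s
    constructor
    · rintro ⟨y, hy, rfl⟩
      refine ⟨Torus.proj (2 * R + 3) y, ?_⟩
      rw [add_right_inj]
      refine congrArg (Torus.proj L) (funext fun i => ?_)
      rw [Torus.proj_apply]
      rw [recentreGeometry_mem_box_iff] at hy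
      have hyi := hy i
      push_cast at hyi
      exact recentreGeometry_valMinAbs_intCast R (y i) hyi
    · rintro ⟨s₀, rfl⟩
      refine ⟨fun i => (s₀ i).valMinAbs, ?_, rfl⟩
      rw [recentreGeometry_mem_box_iff]
      intro i
      push_cast
      exact recentreGeometry_abs_valMinAbs_le R (s₀ i)
  · -- the radius-R cube around 0 goes onto the radius-R cube around x
    intro s₀
    constructor
    · rintro ⟨y, hy, h⟩
      refine ⟨y, hy, ?_⟩
      rw [zero_add]
      have h' := add_left_cancel h
      rw [recentreGeometry_mem_box_iff] at hy
      funext i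
      have hi := congr_fun h' i
      simp only [Torus.proj_apply] at hi
      have hyi : |y i| ≤ (R : ℤ) + 1 := (hy i).trans (by linarith)
      have key := recentreGeometry_intCast_eq R L hL _ _
        (recentreGeometry_abs_valMinAbs_le R (s₀ i)) hyi hi
      rw [Torus.proj_apply, ← key, ZMod.coe_valMinAbs]
    · rintro ⟨y, hy, rfl⟩
      refine ⟨y, hy, ?_⟩
      rw [add_right_inj]
      refine congrArg (Torus.proj L) (funext fun i => ?_)
      rw [zero_add, Torus.proj_apply]
      rw [recentreGeometry_mem_box_iff] at hy
      exact recentreGeometry_valMinAbs_intCast R (y i) ((hy i).trans (by linarith))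
  · -- the centre goes to x
    funext i
    simp

end Summit.QuantumFields.QCD.Cruxes.WegnerEstimate.ResolventCell
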